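import Literature.AnabelianGeometry.SemiGraphs.TemperedEdgeLikeCentralizerOfSeparated
import Literature.AnabelianGeometry.SemiGraphs.TemperedSeparatingQuotientOfCovering
import Literature.AnabelianGeometry.SemiGraphs.CoveringProducts
import HarnessLib

/-!
# (R3c) `EdgeLikeCentralizerAt` from COVERING SEPARATION: a hostable edge forces a deck-equivariant
# transport of fibres in EVERY tempered covering ([SemiAnbd] Cor. 3.9 p. 43 l. 13; Thm. 3.7 (iii) p. 41)

Mochizuki, *Semi-graphs of anabelioids*, Publ. RIMS **42** (2006), §3: Thm. 3.7 (iii) p. 41 (the edge-like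
subgroups "images of '`π̂₁(G_e)`'s" via the restriction `S ↦ S_e`), Cor. 3.9 p. 43 l. 13 ("[again by Theorem 3.7,
(iii), (iv)]" — the step (R3c) `EdgeLikeCentralizerAt` of abc-iut-L3-d4's cut `TemperedReconstructionR3Sub`)
[cite: MochizukiSemiAnbd2006, Thm 3.7(iii) p.41] [cite: MochizukiSemiAnbd2006, Cor 3.9 p.43].

PROOF-ONLY file (abc-iut cell, layer L3 [SemiAnbd], block-F seat abc-iut-f-169 gen 4; FACT-LIST row **F-2772**
`ProfiniteSemiGraph.EdgeLikeCentralizerAt`, L3-lead row «F2772-INSTANCE@HOSTABLE-CORE» δ56 (2); 0 `def` · 0 `instance` ·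
0 notation · 0 `Prop` fact · 0 `sorry`).  F-2772's bare ∀-closure is REFUTED-AS-TYPED at a degenerate witness
(abc-iut-f-140, `TrivialLoop.not_forall_edgeLikeCentralizerAt`, p512532); what is proved here is a positive CLASS
criterion, at OUR typing, in COVERING CURRENCY.

## What is proved (every chart `c : TemperedPiChart ℋ`; §1–§3 need NO hypothesis on `ℋ`)

abc-iut-f-176's finite-quotient separation test (`TemperedEdgeLikeCentralizerOfSeparated`, p506674:
`exists_conj_map_le_of_le_of_mem_edgeLikeSubgroups` — "hostable ⇒ conjugate in every quotient `ρ : π₁^temp(H) → F`")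
needs a homomorphism OUT OF the chart group `c.G`, which a concrete carrier cannot write down (the chart is abstract:
`c.equiv : B^temp(H) ≌ B^temp(c.G)`).  This file moves the test into the category of coverings of `ℋ` itself:

* §1 `IsEdgeHom.exists_equiv_naturalEnd` — Thm. 3.7 (iii) read in `B^temp(H)` NATURALLY: an edge homomorphism
  `ψ : Π_e → c.G` identifies `S_e` with the chart image `c(S)|_ψ` by ONE bijection that commutes with (the images of)
  ALL endomorphisms `δ : S ⟶ S` (edge twin, along endomorphisms, of `IsVerticialHom.exists_equiv_natural`; the
  per-object form is abc-iut-L3-t11's `IsEdgeHom.exists_equiv`).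
* §2 `exists_equiv_transport_of_map_le_of_mem_edgeLikeSubgroups` — **hostable ⇒ equivariant transport**: if the
  piece `ψ(U)` (`U ≤ Π_e`) lies in an edge-like subgroup at `e′`, then for EVERY tempered covering `S` there is a
  bijection `f : S_e ≃ S_{e′}` that (i) commutes with every endomorphism of `S` (DECK-EQUIVARIANCE) and (ii) carries
  the action of each `u ∈ U` on `S_e` to the action of some `γ ∈ Π_{e′}` on `S_{e′}`.
* §3 the contrapositive **COVERING-SEPARATION TEST** `not_exists_edgeLike_ge_of_coveringSeparated` (ONE covering
  without such an `f` certifies that `e′` is not `ψ(U)`-hostable), `finite_hostable_of_coveringSeparated`, and — with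
  abc-iut-f-176's `edgeLikeCentralizerAt_of_finite_hostable(_small)` BY NAME — the CLASS CLOSERS
  `edgeLikeCentralizerAt_of_coveringSeparated`, `…_small` (`Cor39Hypotheses ℋ`) and the F-2773-restricted ∀-form
  `edgeLikeCentralizer_of_coveringSeparated`.  The separation hypothesis speaks of coverings of `ℋ` ONLY — no chart,
  no homomorphism out of `π₁^temp(H)` — so a carrier discharges it by EXHIBITING coverings.

Why deck-equivariance (i) matters: separation through the bare kernel of a finite covering (abc-iut-L3-t11's
`exists_openNormal_ker_chartImage`) or through `𝔖(S_e)`-conjugacy forgets how `π₁^temp(H)` sits inside the symmetric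
group; (i) retains it.  For the CONSTANT coverings `const(G/N)` of a graph of groups with constant gluing data
(abc-iut-f-176 gen 6's memo FINDING-hostable-types-residual §3: both branch maps of every edge equal, all vertex groups
`= G`) the deck group contains the right translations of `G/N`, an equivariant `f` is a LEFT translation by some
`h ∈ G`, and (ii) reads `h·A_e(U)·h⁻¹ ≤ A_{e′}·N` — the memo's fold/retraction `ρ : Π → G`, level by level, without
ever naming `ρ` (the constant coverings and that class closer are the announced sequel files).

Binder census: §1–§3 up to `finite_hostable_of_coveringSeparated`: structural data only (chart, edges, `ψ` with
`IsEdgeHom`, `U`, coverings) — LAW 0 · FACT 0 · GAP 0; the closers add `Cor39Hypotheses ℋ` (the Corollary's own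
hypotheses) and the displayed covering-separation hypothesis `hsep`.  HONEST LABEL: a CLASS theorem; whether a given
Cor-3.9 graph with a hostable core is covering-separated is exactly the carrier question left to a later row (no such
carrier is in the tree); finite / locally finite / no-hostable-core graphs are already closed by abc-iut-f-176's
lineage and are not the content here.  typed ≠ proved; class-proved at OUR typing ≠ print's ∀-claim; no side is taken
on [IUTchIII] Cor. 3.12; nothing here asserts that abc is proved or refuted.
-/

namespace Literature.AnabelianGeometry.SemiGraphs

namespace ProfiniteSemiGraph

open CategoryTheory Topology

universe u

variable {ℋ : ProfiniteSemiGraph.{u}}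

/-! ### 1. Thm. 3.7 (iii) read in `B^temp(G)`, NATURALLY along endomorphisms of the covering -/

/-- An edge homomorphism `ψ : Π_e → π₁^temp(H)` identifies the `Π_e`-set `S_e` of every tempered covering `S` with
the chart image `c(S)` restricted along `ψ`, by ONE bijection that is natural along EVERY endomorphism `δ : S ⟶ S`
(the defining natural isomorphism `B^temp(H) → H_e^⊤ ≅ B^temp(ψ)` composed with the unit of the chart, evaluated at
`S`; edge twin of `IsVerticialHom.exists_equiv_natural`). [cite: MochizukiSemiAnbd2006, Thm 3.7(iii) p.41] -/
theorem IsEdgeHom.exists_equiv_naturalEnd {c : TemperedPiChart ℋ} {e : ℋ.graph.Edge}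
    {ψ : ℋ.Ge e →ₜ* c.G} (hψ : IsEdgeHom c e ψ) (S : BTempCat ℋ) :
    ∃ ε : (S.obj.SE e).obj.V ≃ (c.equiv.functor.obj S).obj.V,
      (∀ (γ : ℋ.Ge e) (s : (S.obj.SE e).obj.V),
        ε ((S.obj.SE e).obj.ρ γ s) = (c.equiv.functor.obj S).obj.ρ (ψ γ) (ε s)) ∧
      ∀ (δ : S ⟶ S) (s : (S.obj.SE e).obj.V),
        ε ((δ.hom.fE e).hom.hom s) = (c.equiv.functor.map δ).hom.hom.hom (ε s) := by
  obtain ⟨η⟩ := hψ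
  let i : S.obj.SE e ≅ (BTemp.res ψ).obj (c.equiv.functor.obj S) :=
    (ObjectProperty.ι _ ⋙ restrictE ℋ e).mapIso (c.equiv.unitIso.app S) ≪≫
      η.app (c.equiv.functor.obj S)
  refine ⟨BTemp.equivOfIso i, fun γ s => BTemp.equivOfIso_ρ i γ s, fun δ s => ?_⟩
  let w : ∀ T : BTempCat ℋ, (T.obj.SE e).obj.V →
      (((c.equiv.functor ⋙ c.equiv.inverse).obj T).obj.SE e).obj.V :=
    fun T x => ((c.equiv.unitIso.hom.app T).hom.fE e).hom.hom x
  have h1 : w S ((δ.hom.fE e).hom.hom s) =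
      ((c.equiv.inverse.map (c.equiv.functor.map δ)).hom.fE e).hom.hom (w S s) := by
    have := congrArg (fun φ => ((ObjectProperty.ι _ ⋙ restrictE ℋ e).map φ).hom.hom s)
      (c.equiv.unitIso.hom.naturality δ)
    exact this
  have h2 : (η.hom.app (c.equiv.functor.obj S)).hom.hom
        (((c.equiv.inverse.map (c.equiv.functor.map δ)).hom.fE e).hom.hom (w S s)) =
      (c.equiv.functor.map δ).hom.hom.hom ((η.hom.app (c.equiv.functor.obj S)).hom.hom (w S s)) := by
    have := congrArg (fun φ => φ.hom.hom (w S s)) (η.hom.naturality (c.equiv.functor.map δ))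
    exact this
  change (η.hom.app (c.equiv.functor.obj S)).hom.hom (w S ((δ.hom.fE e).hom.hom s)) =
    (c.equiv.functor.map δ).hom.hom.hom ((η.hom.app (c.equiv.functor.obj S)).hom.hom (w S s))
  rw [h1, h2]

/-! ### 2. Hostable ⇒ equivariant transport of fibres -/

/-- **Hostable ⇒ a deck-equivariant transport of fibres.**  Let `ψ` be an edge homomorphism at `e`, `U ≤ Π_e`, and
suppose the piece `ψ(U)` lies in an edge-like subgroup `L` at `e′`.  Then for EVERY tempered covering `S` there is a
bijection `f : S_e ≃ S_{e′}` which (i) commutes with every endomorphism `δ` of `S` (`f ∘ δ_e = δ_{e′} ∘ f`) and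
(ii) carries the action of each `u ∈ U` on `S_e` to the action of some `γ ∈ Π_{e′}` on `S_{e′}`.  (Thm. 3.7 (iii):
`L = ψ′(Π_{e′})` for an edge homomorphism `ψ′`; `f := ε_{ψ′}⁻¹ ∘ ε_ψ` through the chart image `c(S)`.)
[cite: MochizukiSemiAnbd2006, Thm 3.7(iii) p.41] -/
theorem exists_equiv_transport_of_map_le_of_mem_edgeLikeSubgroups (c : TemperedPiChart ℋ)
    {e e' : ℋ.graph.Edge} {ψ : ℋ.Ge e →ₜ* c.G} (hψ : IsEdgeHom c e ψ) {U : Subgroup (ℋ.Ge e)}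
    {L : Subgroup c.G} (hL : L ∈ edgeLikeSubgroups c e') (hUL : U.map ψ.toMonoidHom ≤ L)
    (S : BTempCat ℋ) :
    ∃ f : (S.obj.SE e).obj.V ≃ (S.obj.SE e').obj.V,
      (∀ (δ : S ⟶ S) (s : (S.obj.SE e).obj.V),
        f ((δ.hom.fE e).hom.hom s) = (δ.hom.fE e').hom.hom (f s)) ∧
      ∀ u ∈ U, ∃ γ : ℋ.Ge e', ∀ s : (S.obj.SE e).obj.V,
        f ((S.obj.SE e).obj.ρ u s) = (S.obj.SE e').obj.ρ γ (f s) := by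
  obtain ⟨ψ', hψ', rfl⟩ := (mem_edgeLikeSubgroups_iff_exists_isEdgeHom c e' L).mp hL
  obtain ⟨ε, hερ, hεδ⟩ := hψ.exists_equiv_naturalEnd S
  obtain ⟨ε', hε'ρ, hε'δ⟩ := hψ'.exists_equiv_naturalEnd S
  refine ⟨ε.trans ε'.symm, fun δ s => ?_, fun u hu => ?_⟩
  · simp only [Equiv.trans_apply]
    rw [hεδ δ s]
    apply ε'.injective
    rw [Equiv.apply_symm_apply, hε'δ δ, Equiv.apply_symm_apply]
  · obtain ⟨γ, hγ⟩ : ∃ γ : ℋ.Ge e', ψ' γ = ψ u := by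
      have hmem : ψ u ∈ ψ'.toMonoidHom.range := hUL (Subgroup.mem_map.mpr ⟨u, hu, rfl⟩)
      obtain ⟨γ, hγ⟩ := MonoidHom.mem_range.mp hmem
      exact ⟨γ, hγ⟩
    refine ⟨γ, fun s => ?_⟩
    simp only [Equiv.trans_apply]
    rw [hερ u s]
    apply ε'.injective
    rw [Equiv.apply_symm_apply, hε'ρ γ, Equiv.apply_symm_apply, hγ]

/-! ### 3. The COVERING-SEPARATION test and (R3c) -/

/-- **The COVERING-SEPARATION test.**  If SOME tempered covering `S` admits NO deck-equivariant bijection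
`S_e ≃ S_{e′}` carrying the action of `U ≤ Π_e` on `S_e` into the `Π_{e′}`-action on `S_{e′}`, then NO edge-like
subgroup at `e′` contains the piece `ψ(U)`: the edge `e′` is not `ψ(U)`-hostable.  The hypothesis mentions no chart.
[cite: MochizukiSemiAnbd2006, Thm 3.7(iii) p.41] -/
theorem not_exists_edgeLike_ge_of_coveringSeparated (c : TemperedPiChart ℋ) {e e' : ℋ.graph.Edge}
    {ψ : ℋ.Ge e →ₜ* c.G} (hψ : IsEdgeHom c e ψ) {U : Subgroup (ℋ.Ge e)} (S : BTempCat ℋ)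
    (hsep : ∀ f : (S.obj.SE e).obj.V ≃ (S.obj.SE e').obj.V,
      (∀ (δ : S ⟶ S) (s : (S.obj.SE e).obj.V),
        f ((δ.hom.fE e).hom.hom s) = (δ.hom.fE e').hom.hom (f s)) →
      ¬ ∀ u ∈ U, ∃ γ : ℋ.Ge e', ∀ s : (S.obj.SE e).obj.V,
        f ((S.obj.SE e).obj.ρ u s) = (S.obj.SE e').obj.ρ γ (f s)) :
    ¬ ∃ L ∈ edgeLikeSubgroups c e', U.map ψ.toMonoidHom ≤ L := by
  rintro ⟨L, hL, hUL⟩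
  obtain ⟨f, hfδ, hfρ⟩ := exists_equiv_transport_of_map_le_of_mem_edgeLikeSubgroups c hψ hL hUL S
  exact hsep f hfδ hfρ

/-- **Covering separation outside a finite set ⇒ finitely many hostable edges.**
[cite: MochizukiSemiAnbd2006, Thm 3.7(iii) p.41] -/
theorem finite_hostable_of_coveringSeparated (c : TemperedPiChart ℋ) {e : ℋ.graph.Edge}
    {ψ : ℋ.Ge e →ₜ* c.G} (hψ : IsEdgeHom c e ψ) {U : Subgroup (ℋ.Ge e)} {E₀ : Set ℋ.graph.Edge}
    (hE₀ : E₀.Finite)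
    (hsep : ∀ e' ∉ E₀, ∃ S : BTempCat ℋ, ∀ f : (S.obj.SE e).obj.V ≃ (S.obj.SE e').obj.V,
      (∀ (δ : S ⟶ S) (s : (S.obj.SE e).obj.V),
        f ((δ.hom.fE e).hom.hom s) = (δ.hom.fE e').hom.hom (f s)) →
      ¬ ∀ u ∈ U, ∃ γ : ℋ.Ge e', ∀ s : (S.obj.SE e).obj.V,
        f ((S.obj.SE e).obj.ρ u s) = (S.obj.SE e').obj.ρ γ (f s)) :
    {e' : ℋ.graph.Edge | ∃ L ∈ edgeLikeSubgroups c e', U.map ψ.toMonoidHom ≤ L}.Finite := by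
  refine hE₀.subset fun e' he' => ?_
  by_contra hE
  obtain ⟨S, hS⟩ := hsep e' hE
  exact not_exists_edgeLike_ge_of_coveringSeparated c hψ S hS he'

/-- **(R3c) F-2772 `EdgeLikeCentralizerAt ℋ c` from COVERING SEPARATION, at every chart of every Cor-3.9 graph of
anabelioids**: if for every edge `e`, every open `U ≤ Π_e` and all but finitely many edges `e′` some tempered covering
`S` admits no deck-equivariant transport `S_e ≃ S_{e′}` of the `U`-action into the `Π_{e′}`-action, then the
centraliser of every open edge piece `ψ(U)` lies in each of its verticial hosts (via abc-iut-f-176's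
`edgeLikeCentralizerAt_of_finite_hostable`).  The separation hypothesis is a statement about coverings of `ℋ` alone
(no chart, no homomorphism out of `π₁^temp(H)`).  CLASS theorem at OUR typing; F-2772's bare ∀-closure is
refuted-as-typed at a degenerate witness (abc-iut-f-140, `TrivialLoop.not_forall_edgeLikeCentralizerAt`).
[cite: MochizukiSemiAnbd2006, Cor 3.9 p.43] -/
theorem edgeLikeCentralizerAt_of_coveringSeparated (hℋ : Cor39Hypotheses ℋ) (c : TemperedPiChart ℋ)
    (hsep : ∀ (e : ℋ.graph.Edge) (U : Subgroup (ℋ.Ge e)), IsOpen (U : Set (ℋ.Ge e)) →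
      ∃ E₀ : Set ℋ.graph.Edge, E₀.Finite ∧ ∀ e' ∉ E₀, ∃ S : BTempCat ℋ,
        ∀ f : (S.obj.SE e).obj.V ≃ (S.obj.SE e').obj.V,
          (∀ (δ : S ⟶ S) (s : (S.obj.SE e).obj.V),
            f ((δ.hom.fE e).hom.hom s) = (δ.hom.fE e').hom.hom (f s)) →
          ¬ ∀ u ∈ U, ∃ γ : ℋ.Ge e', ∀ s : (S.obj.SE e).obj.V,
            f ((S.obj.SE e).obj.ρ u s) = (S.obj.SE e').obj.ρ γ (f s)) :
    EdgeLikeCentralizerAt ℋ c := by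
  refine edgeLikeCentralizerAt_of_finite_hostable hℋ c fun e ψ hψ U hU => ?_
  obtain ⟨E₀, hE₀, hsep'⟩ := hsep e U hU
  exact finite_hostable_of_coveringSeparated c hψ hE₀ hsep'

/-- **(R3c) from covering separation for SMALL open pieces only** (centralisers are antitone, abc-iut-f-176's
SHRINKAGE `edgeLikeCentralizerAt_of_finite_hostable_small`): it suffices that every open `U ≤ Π_e` contain an open
`U′` all but finitely many of whose far edges are covering-separated from `U′`.
[cite: MochizukiSemiAnbd2006, Cor 3.9 p.43] -/
theorem edgeLikeCentralizerAt_of_coveringSeparated_small (hℋ : Cor39Hypotheses ℋ) (c : TemperedPiChart ℋ)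
    (hsep : ∀ (e : ℋ.graph.Edge) (U : Subgroup (ℋ.Ge e)), IsOpen (U : Set (ℋ.Ge e)) →
      ∃ U' : Subgroup (ℋ.Ge e), U' ≤ U ∧ IsOpen (U' : Set (ℋ.Ge e)) ∧
      ∃ E₀ : Set ℋ.graph.Edge, E₀.Finite ∧ ∀ e' ∉ E₀, ∃ S : BTempCat ℋ,
        ∀ f : (S.obj.SE e).obj.V ≃ (S.obj.SE e').obj.V,
          (∀ (δ : S ⟶ S) (s : (S.obj.SE e).obj.V),
            f ((δ.hom.fE e).hom.hom s) = (δ.hom.fE e').hom.hom (f s)) →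
          ¬ ∀ u ∈ U', ∃ γ : ℋ.Ge e', ∀ s : (S.obj.SE e).obj.V,
            f ((S.obj.SE e).obj.ρ u s) = (S.obj.SE e').obj.ρ γ (f s)) :
    EdgeLikeCentralizerAt ℋ c := by
  refine edgeLikeCentralizerAt_of_finite_hostable_small hℋ c fun e ψ hψ U hU => ?_
  obtain ⟨U', hU'U, hU', E₀, hE₀, hsep'⟩ := hsep e U hU
  exact ⟨U', hU'U, hU', finite_hostable_of_coveringSeparated c hψ hE₀ hsep'⟩

/-- **F-2773 `EdgeLikeCentralizer` RESTRICTED to covering-separated Cor-3.9 graphs, hypothesis-free** (the bare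
∀-fact F-2773 also ranges over graphs with an open edge piece whose far edges no covering separates — the residual
(R1)–(R2) of abc-iut-f-176's memo, not treated here). [cite: MochizukiSemiAnbd2006, Cor 3.9 p.43] -/
theorem edgeLikeCentralizer_of_coveringSeparated :
    ∀ (ℋ : ProfiniteSemiGraph.{u}), Cor39Hypotheses ℋ →
      (∀ (e : ℋ.graph.Edge) (U : Subgroup (ℋ.Ge e)), IsOpen (U : Set (ℋ.Ge e)) →
        ∃ E₀ : Set ℋ.graph.Edge, E₀.Finite ∧ ∀ e' ∉ E₀, ∃ S : BTempCat ℋ,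
          ∀ f : (S.obj.SE e).obj.V ≃ (S.obj.SE e').obj.V,
            (∀ (δ : S ⟶ S) (s : (S.obj.SE e).obj.V),
              f ((δ.hom.fE e).hom.hom s) = (δ.hom.fE e').hom.hom (f s)) →
            ¬ ∀ u ∈ U, ∃ γ : ℋ.Ge e', ∀ s : (S.obj.SE e).obj.V,
              f ((S.obj.SE e).obj.ρ u s) = (S.obj.SE e').obj.ρ γ (f s)) →
      ∀ (c : TemperedPiChart ℋ), EdgeLikeCentralizerAt ℋ c :=
  fun _ hℋ hsep c => edgeLikeCentralizerAt_of_coveringSeparated hℋ c hsep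

/-! ### 4. (v2, append-only) UNIFORM transport: one transfer map `τ : U → Π_{e′}` for ALL coverings, natural along
ALL morphisms of coverings -/

/-- Thm. 3.7 (iii) read in `B^temp(G)` as a NATURAL family: an edge homomorphism `ψ : Π_e → π₁^temp(H)` identifies `S_e`
with the chart image `c(S)|_ψ` by ONE bijection `ε_S` PER COVERING, equivariant, and natural along EVERY morphism `f : S ⟶ S′`
of tempered coverings (not only endomorphisms). [cite: MochizukiSemiAnbd2006, Thm 3.7(iii) p.41] -/
theorem IsEdgeHom.exists_equiv_natural_family {c : TemperedPiChart ℋ} {e : ℋ.graph.Edge}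
    {ψ : ℋ.Ge e →ₜ* c.G} (hψ : IsEdgeHom c e ψ) :
    ∃ ε : ∀ S : BTempCat ℋ, (S.obj.SE e).obj.V ≃ (c.equiv.functor.obj S).obj.V,
      (∀ (S : BTempCat ℋ) (γ : ℋ.Ge e) (s : (S.obj.SE e).obj.V),
        ε S ((S.obj.SE e).obj.ρ γ s) = (c.equiv.functor.obj S).obj.ρ (ψ γ) (ε S s)) ∧
      ∀ (S S' : BTempCat ℋ) (δ : S ⟶ S') (s : (S.obj.SE e).obj.V),
        ε S' ((δ.hom.fE e).hom.hom s) = (c.equiv.functor.map δ).hom.hom.hom (ε S s) := by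
  obtain ⟨η⟩ := hψ
  let i : ∀ S : BTempCat ℋ, S.obj.SE e ≅ (BTemp.res ψ).obj (c.equiv.functor.obj S) := fun S =>
    (ObjectProperty.ι _ ⋙ restrictE ℋ e).mapIso (c.equiv.unitIso.app S) ≪≫ η.app (c.equiv.functor.obj S)
  refine ⟨fun S => BTemp.equivOfIso (i S), fun S γ s => BTemp.equivOfIso_ρ (i S) γ s, fun S S' δ s => ?_⟩
  let w : ∀ T : BTempCat ℋ, (T.obj.SE e).obj.V →
      (((c.equiv.functor ⋙ c.equiv.inverse).obj T).obj.SE e).obj.V :=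
    fun T x => ((c.equiv.unitIso.hom.app T).hom.fE e).hom.hom x
  have h1 : w S' ((δ.hom.fE e).hom.hom s) =
      ((c.equiv.inverse.map (c.equiv.functor.map δ)).hom.fE e).hom.hom (w S s) := by
    have := congrArg (fun φ => ((ObjectProperty.ι _ ⋙ restrictE ℋ e).map φ).hom.hom s)
      (c.equiv.unitIso.hom.naturality δ)
    exact this
  have h2 : (η.hom.app (c.equiv.functor.obj S')).hom.hom
        (((c.equiv.inverse.map (c.equiv.functor.map δ)).hom.fE e).hom.hom (w S s)) =
      (c.equiv.functor.map δ).hom.hom.hom ((η.hom.app (c.equiv.functor.obj S)).hom.hom (w S s)) := by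
    have := congrArg (fun φ => φ.hom.hom (w S s)) (η.hom.naturality (c.equiv.functor.map δ))
    exact this
  change (η.hom.app (c.equiv.functor.obj S')).hom.hom (w S' ((δ.hom.fE e).hom.hom s)) =
    (c.equiv.functor.map δ).hom.hom.hom ((η.hom.app (c.equiv.functor.obj S)).hom.hom (w S s))
  rw [h1, h2]

/-- **Hostable ⇒ UNIFORM equivariant transport (one transfer map for all coverings).**  If the piece `ψ(U)` lies in an
edge-like subgroup at `e′`, there are (a) ONE function `τ : U → Π_{e′}` (independent of the covering) and (b) for EVERY tempered
covering `S` a bijection `f_S : S_e ≃ S_{e′}`, such that the family `(f_S)` is natural along EVERY morphism of coverings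
`S ⟶ S′` (in particular deck-equivariant) and `f_S (u · s) = τ(u) · f_S s` for all `u ∈ U`, all `S`, all `s`.  The residual of
F-2773 must therefore defeat a COHERENT family of fibre transports across the whole category `B^temp(H)`, not merely one covering
at a time. [cite: MochizukiSemiAnbd2006, Thm 3.7(iii) p.41] -/
theorem exists_uniform_transport_of_map_le_of_mem_edgeLikeSubgroups (c : TemperedPiChart ℋ)
    {e e' : ℋ.graph.Edge} {ψ : ℋ.Ge e →ₜ* c.G} (hψ : IsEdgeHom c e ψ) {U : Subgroup (ℋ.Ge e)}
    {L : Subgroup c.G} (hL : L ∈ edgeLikeSubgroups c e') (hUL : U.map ψ.toMonoidHom ≤ L) :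
    ∃ (τ : U → ℋ.Ge e') (f : ∀ S : BTempCat ℋ, (S.obj.SE e).obj.V ≃ (S.obj.SE e').obj.V),
      (∀ (S S' : BTempCat ℋ) (δ : S ⟶ S') (s : (S.obj.SE e).obj.V),
        f S' ((δ.hom.fE e).hom.hom s) = (δ.hom.fE e').hom.hom (f S s)) ∧
      ∀ (S : BTempCat ℋ) (u : U) (s : (S.obj.SE e).obj.V),
        f S ((S.obj.SE e).obj.ρ (u : ℋ.Ge e) s) = (S.obj.SE e').obj.ρ (τ u) (f S s) := by
  obtain ⟨ψ', hψ', rfl⟩ := (mem_edgeLikeSubgroups_iff_exists_isEdgeHom c e' L).mp hL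
  obtain ⟨ε, hερ, hεδ⟩ := hψ.exists_equiv_natural_family
  obtain ⟨ε', hε'ρ, hε'δ⟩ := hψ'.exists_equiv_natural_family
  have hτ : ∀ u : U, ∃ γ : ℋ.Ge e', ψ' γ = ψ (u : ℋ.Ge e) := fun u => by
    have hmem : ψ (u : ℋ.Ge e) ∈ ψ'.toMonoidHom.range := hUL (Subgroup.mem_map.mpr ⟨u, u.2, rfl⟩)
    obtain ⟨γ, hγ⟩ := MonoidHom.mem_range.mp hmem
    exact ⟨γ, hγ⟩
  choose τ hτ using hτ
  refine ⟨τ, fun S => (ε S).trans (ε' S).symm, fun S S' δ s => ?_, fun S u s => ?_⟩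
  · simp only [Equiv.trans_apply]
    rw [hεδ S S' δ s]
    apply (ε' S').injective
    rw [Equiv.apply_symm_apply, hε'δ S S' δ, Equiv.apply_symm_apply]
  · simp only [Equiv.trans_apply]
    rw [hερ S _ s]
    apply (ε' S).injective
    rw [Equiv.apply_symm_apply, hε'ρ S (τ u), Equiv.apply_symm_apply, hτ u]

end ProfiniteSemiGraph

end Literature.AnabelianGeometry.SemiGraphs
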